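import Mathlib
import HarnessLib.Audit
import Summits.PneNP.PneNP.Theorems.PstarChordReadPrivSwitch
import Summits.PneNP.PneNP.Theorems.PstarChordReadRestrictVar

/-!
# Fully coupled chords: the second reader is the NOR of the two private directions, and that kills (memo g21 §16, steps 4–5)

FRONTIER range-avoidance ladder, rung F-N3, ROUND 24 (cell `pnp-ideate`, prover-2 memo `g21/O1-CHORD-READ-g21.md` §16 (the general two-chord
theorem, FULL–FULL branch); typed target `PstarCoreBoundTargets.TerminalPeelable` (p646951); restricted-model proof complexity — nothing here bears
on `P` versus `NP`).

Setting (type `(1,0)`, after `PstarChordReadPrivSwitch`): two distinct non-parallel slice-generic chords `cᵢ, cⱼ` with outside gates `gᵢ = (vᵢ, zᵢ)`,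
`gⱼ = (vⱼ, zⱼ)` in `G₁`, `Γ₂` blind to both AND pairs and to `vᵢ, vⱼ`, and the FULL relations `mv₂ zᵢ ≡ ¬ live₁(vⱼ)`, `mv₂ zⱼ ≡ ¬ live₁(vᵢ)`
(`live₁(v) = mv₁ v`: the private `v` currently moves `Γ₁`).  This is the complete-bipartite coupling of the two chords' switches — the residual the
affine theorem could not touch.  It dies:

* `gval₂_ne_of_mv` — pointwise free lunch: an outside variable moving `Γ₁` and not `Γ₂` at a solution makes `Γ₂` fail there;
* `ne_of_live` — on the slice `co-private(cᵢ) = 0`, wherever `vⱼ` is live, `Γ₂` fails (free lunch with transport: `mv zᵢ = (1,0)` at the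
  `vᵢ`-toggle point);  `formula_on_slice` — hence on that slice `Γ₂ = b₂ ⟺ both privates are DEAD` (flip `zⱼ` where `vⱼ` is dead);
* `formula` — **`Γ₂ ≡ ¬b₂ ⊕ NOR(live₁(vᵢ), live₁(vⱼ))` EVERYWHERE**: restrict the partners `Z` of `vᵢ, vⱼ` to the values of any point
  (`PstarChordReadRestrictVar.restrictL`); the restricted `Γ₂` is constant on the slices of `cᵢ` and of `cⱼ`, hence chord-local at both (slice lemma),
  hence identically `false` (`gval_eq_false_of_two_chordLocal`) — `Γ₂` depends on the `Z`-coordinates only;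
* `false_of_full` — **the kill**: every (M0) witness lies in a both-dead `Z`-fibre, where `Γ₂ ≡ b₂`, so (T3) makes the restricted `Γ₁` miss `b₁` on
  `Sol(J₀)`; by `gSat` it is constant — but it equals `b₁` at the witness.

Genericity used: `SliceGeneric` at `cᵢ` and at `cⱼ`.  No realisability hypotheses; no Assumption A.
-/

set_option linter.dupNamespace false -- `Summit.PneNP.PneNP.…`: summit = sub-problem name (D-0017 single-conjunct layout)

open Finset Literature.Computability.Complexity
open scoped symmDiff
open Summit.PneNP.PneNP.Theorems.PstarFibrePolys (bit bit_injective)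
open Summit.PneNP.PneNP.Theorems.PstarTyped (Typed)
open Summit.PneNP.PneNP.Theorems.PstarSALevel (varSet bdry BoundaryExpanding SimpleOverlap)
open Summit.PneNP.PneNP.Theorems.PstarGapPeeling (not_mem_varSet_of_private)
open Summit.PneNP.PneNP.Theorems.PstarCentreFree (vars_mem_varSet)
open Summit.PneNP.PneNP.Theorems.PstarGapOneAll (gval)
open Summit.PneNP.PneNP.Theorems.PstarGConstraint (bit_gval gval_update_of_forall_ne)
open Summit.PneNP.PneNP.Theorems.PstarChordRepair (IsChord)
open Summit.PneNP.PneNP.Theorems.PstarCoreBoundTargets (Terminal)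
open Summit.PneNP.PneNP.Theorems.PstarGSat (gSat)
open Summit.PneNP.PneNP.Theorems.PstarChordReadSwitch (solves_update_of_outside gval_eq_false_of_two_chordLocal)
open Summit.PneNP.PneNP.Theorems.PstarChordReadLemma (ChordLocal SliceGeneric chordLocal_of_fail_slice)
open Summit.PneNP.PneNP.Theorems.PstarChordReadGates (sliceGeneric_mono exists_two_slices)
open Summit.PneNP.PneNP.Theorems.PstarChordReadFlip
open Summit.PneNP.PneNP.Theorems.PstarChordReadOutside
open Summit.PneNP.PneNP.Theorems.PstarChordReadOutsideClean
open Summit.PneNP.PneNP.Theorems.PstarChordReadRestrictVar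

namespace Summit.PneNP.PneNP.Theorems.PstarChordReadNor

variable {n m : ℕ}

/-! ## Linear forms and fibre lists -/
section Fibre

variable (I : LocalMap 4 n m)

/-- A linear G-constraint depends only on its variables. -/
theorem gval_lin_congr (P : Finset (Fin n)) {x x' : Fin n → Bool} (h : ∀ u ∈ P, x u = x' u) : gval I P ∅ x = gval I P ∅ x' := by
  apply bit_injective
  rw [bit_gval, bit_gval, sum_empty, sum_empty]
  exact congrArg (· + 0) (sum_congr rfl fun u hu => by rw [h u hu])

/-- The move of `v` depends only on the partners of `v`. -/
theorem mv_congr (hI : I.IsPure xorAndPred) (hS : SimpleOverlap I) (C : Finset (Fin n)) (G : Finset (Fin m)) (v : Fin n) {x x' : Fin n → Bool}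
    (h : ∀ u ∈ partners I G v, x u = x' u) : mv I C G v x = mv I C G v x' := by
  rw [mv_eq_partners I hI hS, mv_eq_partners I hI hS, gval_lin_congr I _ h]

omit I in
/-- The list of (variable, value-at-`w`) over a finset `Z`. -/
noncomputable def fibreList (Z : Finset (Fin n)) (w : Fin n → Bool) : List (Fin n × Bool) := Z.toList.map fun z => (z, w z)

omit I in
/-- Membership in `fibreList`. -/
theorem mem_fibreList {Z : Finset (Fin n)} {w : Fin n → Bool} {p : Fin n × Bool} : p ∈ fibreList Z w ↔ p.1 ∈ Z ∧ p.2 = w p.1 := by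
  unfold fibreList
  rw [List.mem_map]
  constructor
  · rintro ⟨z, hz, rfl⟩; exact ⟨Finset.mem_toList.1 hz, rfl⟩
  · rintro ⟨h1, h2⟩; exact ⟨p.1, Finset.mem_toList.2 h1, by rw [← h2]⟩

omit I in
/-- The keys of `fibreList` have no repetition. -/
theorem fibreList_keys_nodup (Z : Finset (Fin n)) (w : Fin n → Bool) : ((fibreList Z w).map Prod.fst).Nodup := by
  unfold fibreList
  rw [List.map_map]
  have : (Prod.fst ∘ fun z : Fin n => (z, w z)) = id := rfl
  rw [this, List.map_id]
  exact Finset.nodup_toList Z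

omit I in
/-- Overriding by `fibreList Z w` copies `w` on `Z` … -/
theorem overrideL_fibreList_of_mem {Z : Finset (Fin n)} (w x : Fin n → Bool) {z : Fin n} (hz : z ∈ Z) :
    overrideL x (fibreList Z w) z = w z :=
  overrideL_apply_of_mem _ _ (fibreList_keys_nodup Z w) (mem_fibreList.2 ⟨hz, rfl⟩)

omit I in
/-- … and keeps `x` off `Z`. -/
theorem overrideL_fibreList_of_not_mem {Z : Finset (Fin n)} (w x : Fin n → Bool) {v : Fin n} (hv : v ∉ Z) :
    overrideL x (fibreList Z w) v = x v :=
  overrideL_apply_of_not_mem _ _ fun _ hp e => hv (e ▸ (mem_fibreList.1 hp).1)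

omit I in
/-- Overriding `w` by its own values does nothing. -/
theorem overrideL_fibreList_self (Z : Finset (Fin n)) (w : Fin n → Bool) : overrideL w (fibreList Z w) = w :=
  overrideL_eq_self _ _ fun _ hp => (mem_fibreList.1 hp).2.symm

/-- Overriding outside variables keeps the core solved. -/
theorem solves_overrideL_fibreList {y : Fin m → Bool} {J₀ : Finset (Fin m)} {Z : Finset (Fin n)} (hZ : ∀ z ∈ Z, ∀ j ∈ J₀, z ∉ varSet I j)
    (w : Fin n → Bool) {x : Fin n → Bool} (hx : ∀ j ∈ J₀, I.eval x j = y j) : ∀ j ∈ J₀, I.eval (overrideL x (fibreList Z w)) j = y j :=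
  solves_overrideL I _ x (fun p hp => hZ p.1 (mem_fibreList.1 hp).1) hx

end Fibre

/-! ## The NOR structure and the kill -/
section Full

variable {I : LocalMap 4 n m} {r : ℕ} {y : Fin m → Bool} {J₀ : Finset (Fin m)} {w₁ w₂ : Finset (Fin n) × Finset (Fin m) × Bool}

/-- **Pointwise free lunch**: an outside variable moving `Γ₁` and not `Γ₂` at a solution makes `Γ₂` fail there. -/
theorem gval₂_ne_of_mv (hI : I.IsPure xorAndPred) (ht : Terminal I r y J₀ w₁ w₂) {z : Fin n} (hz : ∀ j ∈ J₀, z ∉ varSet I j)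
    {x : Fin n → Bool} (hx : ∀ j ∈ J₀, I.eval x j = y j) (h₁ : mv I w₁.1 w₁.2.1 z x = true) (h₂ : mv I w₂.1 w₂.2.1 z x = false) :
    gval I w₂.1 w₂.2.1 x ≠ w₂.2.2 := by
  intro hg₂
  have hx' := solves_update_of_outside hz hx (!x z)
  have e₁ := gval_flip I w₁.1 w₁.2.1 hI x z
  have e₂ := gval_flip I w₂.1 w₂.2.1 hI x z
  rw [h₁] at e₁
  rw [h₂, Bool.xor_false, hg₂] at e₂
  by_cases hg₁ : gval I w₁.1 w₁.2.1 x = w₁.2.2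
  · exact ht.2.2.2.2.2.2.1 ⟨x, hx, hg₁, hg₂⟩
  · refine ht.2.2.2.2.2.2.1 ⟨_, hx', ?_, e₂⟩
    rw [e₁]; revert hg₁; cases gval I w₁.1 w₁.2.1 x <;> cases w₁.2.2 <;> decide

variable {cᵢ cⱼ gᵢ gⱼ : Fin m} {vᵢ vᵢ' zᵢ vⱼ vⱼ' zⱼ : Fin n}

/-- **Where `vⱼ` is live, `Γ₂` fails on the slice of `cᵢ`.**  Gate `gᵢ = (vᵢ, zᵢ) ∈ G₁` on `cᵢ`, `Γ₂` blind to `vᵢ`, the FULL relation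
`mv₂ zᵢ ≡ ¬ mv₁ vⱼ`, no cross monomial `(vᵢ, vⱼ)`: at a solution with `x_{vᵢ'} = 0` and `mv₁ vⱼ x = 1`, `Γ₂ x ≠ b₂`. -/
theorem ne_of_live (hI : I.IsPure xorAndPred) (hS : SimpleOverlap I) (ht : Terminal I r y J₀ w₁ w₂) (hcᵢ : cᵢ ∈ J₀) (hchᵢ : IsChord I J₀ cᵢ)
    (hvᵢ : (I.vars cᵢ 2 = vᵢ ∧ I.vars cᵢ 3 = vᵢ') ∨ (I.vars cᵢ 2 = vᵢ' ∧ I.vars cᵢ 3 = vᵢ))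
    (hgᵢ₁ : gᵢ ∈ w₁.2.1) (hpᵢ : (I.vars gᵢ 2 = vᵢ ∧ I.vars gᵢ 3 = zᵢ) ∨ (I.vars gᵢ 2 = zᵢ ∧ I.vars gᵢ 3 = vᵢ))
    (hzᵢ : ∀ j ∈ J₀, zᵢ ∉ varSet I j) (hvC : vᵢ ∉ w₂.1) (hvG : ∀ g ∈ w₂.2.1, I.vars g 2 ≠ vᵢ ∧ I.vars g 3 ≠ vᵢ)
    (hncross : ∀ h ∈ w₁.2.1 ∪ w₂.2.1, ¬ ((I.vars h 2 = vⱼ ∧ I.vars h 3 = vᵢ) ∨ (I.vars h 2 = vᵢ ∧ I.vars h 3 = vⱼ)))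
    (hF : ∀ x : Fin n → Bool, mv I w₂.1 w₂.2.1 zᵢ x = !mv I w₁.1 w₁.2.1 vⱼ x)
    {x : Fin n → Bool} (hx : ∀ j ∈ J₀, I.eval x j = y j) (h0 : x vᵢ' = false) (hlive : mv I w₁.1 w₁.2.1 vⱼ x = true) :
    gval I w₂.1 w₂.2.1 x ≠ w₂.2.2 := by
  classical
  have memᵢ : vᵢ ∈ varSet I cᵢ := by
    rcases hvᵢ with ⟨h2, -⟩ | ⟨-, h3⟩
    · exact h2 ▸ vars_mem_varSet I cᵢ 2
    · exact h3 ▸ vars_mem_varSet I cᵢ 3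
  have hvzᵢ : vᵢ ≠ zᵢ := fun e => hzᵢ cᵢ hcᵢ (e ▸ memᵢ)
  set x₁ := Function.update x vᵢ (!x vᵢ) with hx₁
  have hs₁ : ∀ j ∈ J₀, I.eval x₁ j = y j := solves_update_priv hI hcᵢ hchᵢ hvᵢ hx h0 _
  have tog : mv I w₁.1 w₁.2.1 zᵢ x₁ = !mv I w₁.1 w₁.2.1 zᵢ x := by
    rw [hx₁, mv_flip_gate hI hS _ _ hpᵢ hvzᵢ x, decide_eq_true hgᵢ₁]; cases mv I w₁.1 w₁.2.1 zᵢ x <;> rfl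
  have livej₁ : mv I w₁.1 w₁.2.1 vⱼ x₁ = true := by
    rw [hx₁, mv_update_of_ne I _ _ (fun h hh => hncross h (mem_union_left _ hh)) x _]; exact hlive
  have same₂ : gval I w₂.1 w₂.2.1 x₁ = gval I w₂.1 w₂.2.1 x := gval_update_of_forall_ne I x hvC hvG _
  have lunch : ∀ P : Fin n → Bool, (∀ j ∈ J₀, I.eval P j = y j) → mv I w₁.1 w₁.2.1 zᵢ P = true → mv I w₁.1 w₁.2.1 vⱼ P = true →
      gval I w₂.1 w₂.2.1 P ≠ w₂.2.2 :=
    fun P hP h₁ hl => gval₂_ne_of_mv hI ht hzᵢ hP h₁ (by rw [hF P, hl]; rfl)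
  by_cases h : mv I w₁.1 w₁.2.1 zᵢ x = true
  · exact lunch x hx h hlive
  · rw [← same₂]
    exact lunch x₁ hs₁ (by rw [tog]; simpa using h) livej₁

/-- **On the slice of `cᵢ`: `Γ₂ = b₂ ⟺ both privates are dead.**  As in `ne_of_live`, plus the outside gate `gⱼ = (vⱼ, zⱼ) ∈ G₁` on `cⱼ`, the FULL
relation `mv₂ zⱼ ≡ ¬ mv₁ vᵢ`, `zⱼ` in no monomial with `vᵢ`: at a solution with `x_{vᵢ'} = 0`,
`Γ₂ x = ¬b₂ ⊕ (¬ live₁(vᵢ) ∧ ¬ live₁(vⱼ))`. -/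
theorem formula_on_slice (hI : I.IsPure xorAndPred) (hS : SimpleOverlap I) (ht : Terminal I r y J₀ w₁ w₂) (hcᵢ : cᵢ ∈ J₀) (hcⱼ : cⱼ ∈ J₀)
    (hchᵢ : IsChord I J₀ cᵢ)
    (hvᵢ : (I.vars cᵢ 2 = vᵢ ∧ I.vars cᵢ 3 = vᵢ') ∨ (I.vars cᵢ 2 = vᵢ' ∧ I.vars cᵢ 3 = vᵢ))
    (hvⱼ : (I.vars cⱼ 2 = vⱼ ∧ I.vars cⱼ 3 = vⱼ') ∨ (I.vars cⱼ 2 = vⱼ' ∧ I.vars cⱼ 3 = vⱼ))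
    (hgᵢ₁ : gᵢ ∈ w₁.2.1) (hpᵢ : (I.vars gᵢ 2 = vᵢ ∧ I.vars gᵢ 3 = zᵢ) ∨ (I.vars gᵢ 2 = zᵢ ∧ I.vars gᵢ 3 = vᵢ))
    (hzᵢ : ∀ j ∈ J₀, zᵢ ∉ varSet I j)
    (hgⱼ₁ : gⱼ ∈ w₁.2.1) (hpⱼ : (I.vars gⱼ 2 = vⱼ ∧ I.vars gⱼ 3 = zⱼ) ∨ (I.vars gⱼ 2 = zⱼ ∧ I.vars gⱼ 3 = vⱼ))
    (hzⱼ : ∀ j ∈ J₀, zⱼ ∉ varSet I j)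
    (hvC : vᵢ ∉ w₂.1) (hvG : ∀ g ∈ w₂.2.1, I.vars g 2 ≠ vᵢ ∧ I.vars g 3 ≠ vᵢ)
    (hncross : ∀ h ∈ w₁.2.1 ∪ w₂.2.1, ¬ ((I.vars h 2 = vⱼ ∧ I.vars h 3 = vᵢ) ∨ (I.vars h 2 = vᵢ ∧ I.vars h 3 = vⱼ)))
    (hFᵢ : ∀ x : Fin n → Bool, mv I w₂.1 w₂.2.1 zᵢ x = !mv I w₁.1 w₁.2.1 vⱼ x)
    (hFⱼ : ∀ x : Fin n → Bool, mv I w₂.1 w₂.2.1 zⱼ x = !mv I w₁.1 w₁.2.1 vᵢ x)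
    {x : Fin n → Bool} (hx : ∀ j ∈ J₀, I.eval x j = y j) (h0 : x vᵢ' = false) :
    gval I w₂.1 w₂.2.1 x = xor (!w₂.2.2) (!mv I w₁.1 w₁.2.1 vᵢ x && !mv I w₁.1 w₁.2.1 vⱼ x) := by
  classical
  have memᵢ' : vᵢ' ∈ varSet I cᵢ := by
    rcases hvᵢ with ⟨-, h3⟩ | ⟨h2, -⟩
    · exact h3 ▸ vars_mem_varSet I cᵢ 3
    · exact h2 ▸ vars_mem_varSet I cᵢ 2
  have memⱼ : vⱼ ∈ varSet I cⱼ := by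
    rcases hvⱼ with ⟨h2, -⟩ | ⟨-, h3⟩
    · exact h2 ▸ vars_mem_varSet I cⱼ 2
    · exact h3 ▸ vars_mem_varSet I cⱼ 3
  have hzⱼvᵢ' : zⱼ ≠ vᵢ' := fun e => hzⱼ cᵢ hcᵢ (e ▸ memᵢ')
  have hzⱼvⱼ : zⱼ ≠ vⱼ := fun e => hzⱼ cⱼ hcⱼ (e ▸ memⱼ)
  have S1 := fun (P : Fin n → Bool) (hP : ∀ j ∈ J₀, I.eval P j = y j) (hP0 : P vᵢ' = false) (hl : mv I w₁.1 w₁.2.1 vⱼ P = true) =>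
    ne_of_live hI hS ht hcᵢ hchᵢ hvᵢ hgᵢ₁ hpᵢ hzᵢ hvC hvG hncross hFᵢ hP hP0 hl
  by_cases hl : mv I w₁.1 w₁.2.1 vⱼ x = true
  · have h := S1 x hx h0 hl
    rw [hl]; revert h; cases gval I w₂.1 w₂.2.1 x <;> cases w₂.2.2 <;> simp
  · -- flip `zⱼ`: `vⱼ` becomes live, `Γ₂` moves by `¬ live₁(vᵢ)`
    set x' := Function.update x zⱼ (!x zⱼ) with hx'
    have hs' : ∀ j ∈ J₀, I.eval x' j = y j := solves_update_of_outside hzⱼ hx _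
    have h0' : x' vᵢ' = false := by rw [hx', Function.update_of_ne hzⱼvᵢ'.symm]; exact h0
    have hl' : mv I w₁.1 w₁.2.1 vⱼ x' = true := by
      rw [hx', mv_flip_gate hI hS _ _ hpⱼ.symm hzⱼvⱼ x, decide_eq_true hgⱼ₁]; simpa using hl
    have h := S1 x' hs' h0' hl'
    have e₂ : gval I w₂.1 w₂.2.1 x' = xor (gval I w₂.1 w₂.2.1 x) (!mv I w₁.1 w₁.2.1 vᵢ x) := by
      rw [hx', gval_flip I _ _ hI, hFⱼ]
    rw [e₂] at h
    rw [Bool.eq_false_iff.2 hl]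
    revert h; cases gval I w₂.1 w₂.2.1 x <;> cases w₂.2.2 <;> cases mv I w₁.1 w₁.2.1 vᵢ x <;> simp

/-- **THE KILL of the fully coupled pair.** -/
theorem false_of_full (hI : I.IsPure xorAndPred) (hT : Typed I) (hS : SimpleOverlap I) (hB : BoundaryExpanding r I)
    (ht : Terminal I r y J₀ w₁ w₂) (hcᵢ : cᵢ ∈ J₀) (hcⱼ : cⱼ ∈ J₀) (hne : cᵢ ≠ cⱼ) (hchᵢ : IsChord I J₀ cᵢ) (hchⱼ : IsChord I J₀ cⱼ)
    (hv : ∃ s : Fin 4, s.val < 2 ∧ I.vars cᵢ s ∉ varSet I cⱼ)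
    (hvᵢ : (I.vars cᵢ 2 = vᵢ ∧ I.vars cᵢ 3 = vᵢ') ∨ (I.vars cᵢ 2 = vᵢ' ∧ I.vars cᵢ 3 = vᵢ))
    (hvⱼ : (I.vars cⱼ 2 = vⱼ ∧ I.vars cⱼ 3 = vⱼ') ∨ (I.vars cⱼ 2 = vⱼ' ∧ I.vars cⱼ 3 = vⱼ))
    (hgᵢ₁ : gᵢ ∈ w₁.2.1) (hpᵢ : (I.vars gᵢ 2 = vᵢ ∧ I.vars gᵢ 3 = zᵢ) ∨ (I.vars gᵢ 2 = zᵢ ∧ I.vars gᵢ 3 = vᵢ))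
    (hzᵢ : ∀ j ∈ J₀, zᵢ ∉ varSet I j)
    (hgⱼ₁ : gⱼ ∈ w₁.2.1) (hpⱼ : (I.vars gⱼ 2 = vⱼ ∧ I.vars gⱼ 3 = zⱼ) ∨ (I.vars gⱼ 2 = zⱼ ∧ I.vars gⱼ 3 = vⱼ))
    (hzⱼ : ∀ j ∈ J₀, zⱼ ∉ varSet I j)
    (hvᵢC : vᵢ ∉ w₂.1) (hvⱼC : vⱼ ∉ w₂.1)
    (hmonoᵢ : ∀ g ∈ w₂.2.1, (I.vars g 2 ≠ I.vars cᵢ 2 ∧ I.vars g 3 ≠ I.vars cᵢ 2) ∧ (I.vars g 2 ≠ I.vars cᵢ 3 ∧ I.vars g 3 ≠ I.vars cᵢ 3))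
    (hmonoⱼ : ∀ g ∈ w₂.2.1, (I.vars g 2 ≠ I.vars cⱼ 2 ∧ I.vars g 3 ≠ I.vars cⱼ 2) ∧ (I.vars g 2 ≠ I.vars cⱼ 3 ∧ I.vars g 3 ≠ I.vars cⱼ 3))
    (hncross : ∀ h ∈ w₁.2.1 ∪ w₂.2.1, ¬ ((I.vars h 2 = vⱼ ∧ I.vars h 3 = vᵢ) ∨ (I.vars h 2 = vᵢ ∧ I.vars h 3 = vⱼ)))
    (hFᵢ : ∀ x : Fin n → Bool, mv I w₂.1 w₂.2.1 zᵢ x = !mv I w₁.1 w₁.2.1 vⱼ x)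
    (hFⱼ : ∀ x : Fin n → Bool, mv I w₂.1 w₂.2.1 zⱼ x = !mv I w₁.1 w₁.2.1 vᵢ x)
    (hPoutᵢ : ∀ u ∈ partners I w₁.2.1 vᵢ, ∀ j ∈ J₀, u ∉ varSet I j) (hPoutⱼ : ∀ u ∈ partners I w₁.2.1 vⱼ, ∀ j ∈ J₀, u ∉ varSet I j)
    (hgenᵢ : SliceGeneric I y J₀ cᵢ (w₁.2.1 ∪ w₂.2.1)) (hgenⱼ : SliceGeneric I y J₀ cⱼ (w₁.2.1 ∪ w₂.2.1)) : False := by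
  classical
  -- `Γ₂` is blind to `vᵢ, vⱼ`
  have hvGᵢ : ∀ g ∈ w₂.2.1, I.vars g 2 ≠ vᵢ ∧ I.vars g 3 ≠ vᵢ := by
    intro g hg; rcases hvᵢ with ⟨h2, -⟩ | ⟨-, h3⟩
    · rw [← h2]; exact (hmonoᵢ g hg).1
    · rw [← h3]; exact (hmonoᵢ g hg).2
  have hvGⱼ : ∀ g ∈ w₂.2.1, I.vars g 2 ≠ vⱼ ∧ I.vars g 3 ≠ vⱼ := by
    intro g hg; rcases hvⱼ with ⟨h2, -⟩ | ⟨-, h3⟩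
    · rw [← h2]; exact (hmonoⱼ g hg).1
    · rw [← h3]; exact (hmonoⱼ g hg).2
  have hncross' : ∀ h ∈ w₁.2.1 ∪ w₂.2.1, ¬ ((I.vars h 2 = vᵢ ∧ I.vars h 3 = vⱼ) ∨ (I.vars h 2 = vⱼ ∧ I.vars h 3 = vᵢ)) :=
    fun h hh H => hncross h hh H.symm
  -- the formula on the slice of `cᵢ` and on the slice of `cⱼ`
  have Fᵢ := fun (x : Fin n → Bool) (hx : ∀ j ∈ J₀, I.eval x j = y j) (h0 : x vᵢ' = false) =>
    formula_on_slice hI hS ht hcᵢ hcⱼ hchᵢ hvᵢ hvⱼ hgᵢ₁ hpᵢ hzᵢ hgⱼ₁ hpⱼ hzⱼ hvᵢC hvGᵢ hncross hFᵢ hFⱼ hx h0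
  have Fⱼ := fun (x : Fin n → Bool) (hx : ∀ j ∈ J₀, I.eval x j = y j) (h0 : x vⱼ' = false) =>
    formula_on_slice hI hS ht hcⱼ hcᵢ hchⱼ hvⱼ hvᵢ hgⱼ₁ hpⱼ hzⱼ hgᵢ₁ hpᵢ hzᵢ hvⱼC hvGⱼ hncross' hFⱼ hFᵢ hx h0
  -- the outside variables that matter
  set Z : Finset (Fin n) := partners I w₁.2.1 vᵢ ∪ partners I w₁.2.1 vⱼ with hZ
  have hZout : ∀ z ∈ Z, ∀ j ∈ J₀, z ∉ varSet I j := by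
    intro z hz
    rcases mem_union.1 hz with hz | hz
    exacts [hPoutᵢ z hz, hPoutⱼ z hz]
  -- the live bits depend only on the `Z`-coordinates
  have liveᵢ_congr : ∀ x x' : Fin n → Bool, (∀ u ∈ Z, x u = x' u) → mv I w₁.1 w₁.2.1 vᵢ x = mv I w₁.1 w₁.2.1 vᵢ x' :=
    fun x x' h => mv_congr I hI hS _ _ vᵢ fun u hu => h u (mem_union_left _ hu)
  have liveⱼ_congr : ∀ x x' : Fin n → Bool, (∀ u ∈ Z, x u = x' u) → mv I w₁.1 w₁.2.1 vⱼ x = mv I w₁.1 w₁.2.1 vⱼ x' :=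
    fun x x' h => mv_congr I hI hS _ _ vⱼ fun u hu => h u (mem_union_right _ hu)
  -- co-privates on the slices `(0,0)`
  have cofᵢ : ∀ x : Fin n → Bool, x (I.vars cᵢ 2) = false → x (I.vars cᵢ 3) = false → x vᵢ' = false := by
    intro x h2 h3; rcases hvᵢ with ⟨-, h⟩ | ⟨h, -⟩
    · rw [← h]; exact h3
    · rw [← h]; exact h2
  have cofⱼ : ∀ x : Fin n → Bool, x (I.vars cⱼ 2) = false → x (I.vars cⱼ 3) = false → x vⱼ' = false := by
    intro x h2 h3; rcases hvⱼ with ⟨-, h⟩ | ⟨h, -⟩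
    · rw [← h]; exact h3
    · rw [← h]; exact h2
  -- STEP: `Γ₂` depends on the `Z`-coordinates only: for every `w`, `Γ₂` is constant on the fibre of `w`
  have fibre : ∀ w x : Fin n → Bool, gval I w₂.1 w₂.2.1 (overrideL x (fibreList Z w)) =
      xor (!w₂.2.2) (!mv I w₁.1 w₁.2.1 vᵢ w && !mv I w₁.1 w₁.2.1 vⱼ w) := by
    intro w
    set L := fibreList Z w with hL
    set R := restrictL I w₂.1 w₂.2.1 L with hR
    have hR₂ : R.2 ⊆ w₂.2.1 := restrictL_snd_subset I _ _ L
    have agree : ∀ x : Fin n → Bool, ∀ u ∈ Z, overrideL x L u = w u := fun x u hu => overrideL_fibreList_of_mem w x hu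
    set c := xor (!w₂.2.2) (!mv I w₁.1 w₁.2.1 vᵢ w && !mv I w₁.1 w₁.2.1 vⱼ w) with hc
    -- on the slices the restricted reader is the constant `c ⊕ constL`
    have onslice : ∀ x : Fin n → Bool, (∀ j ∈ J₀, I.eval x j = y j) → (x vᵢ' = false ∨ x vⱼ' = false) →
        gval I R.1 R.2 x = xor c (constL I w₂.1 w₂.2.1 L) := by
      intro x hx h0
      rw [hR, gval_restrictL I hI hS]
      have hs := solves_overrideL_fibreList I hZout w hx
      have h0' : overrideL x L vᵢ' = false ∨ overrideL x L vⱼ' = false := by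
        have memᵢ' : vᵢ' ∈ varSet I cᵢ := by
          rcases hvᵢ with ⟨-, h3⟩ | ⟨h2, -⟩
          · exact h3 ▸ vars_mem_varSet I cᵢ 3
          · exact h2 ▸ vars_mem_varSet I cᵢ 2
        have memⱼ' : vⱼ' ∈ varSet I cⱼ := by
          rcases hvⱼ with ⟨-, h3⟩ | ⟨h2, -⟩
          · exact h3 ▸ vars_mem_varSet I cⱼ 3
          · exact h2 ▸ vars_mem_varSet I cⱼ 2
        have nᵢ : vᵢ' ∉ Z := fun h => hZout _ h cᵢ hcᵢ memᵢ'
        have nⱼ : vⱼ' ∉ Z := fun h => hZout _ h cⱼ hcⱼ memⱼ'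
        rcases h0 with h0 | h0
        · left; rw [hL, overrideL_fibreList_of_not_mem w x nᵢ]; exact h0
        · right; rw [hL, overrideL_fibreList_of_not_mem w x nⱼ]; exact h0
      have key : gval I w₂.1 w₂.2.1 (overrideL x L) = c := by
        rcases h0' with h0' | h0'
        · rw [Fᵢ _ hs h0', hc, liveᵢ_congr _ w (agree x), liveⱼ_congr _ w (agree x)]
        · rw [Fⱼ _ hs h0', hc, liveᵢ_congr _ w (agree x), liveⱼ_congr _ w (agree x), Bool.and_comm]
      rw [key]
    have locᵢ : ChordLocal I cᵢ R.1 R.2 :=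
      chordLocal_of_fail_slice hI hcᵢ hchᵢ (sliceGeneric_mono (hR₂.trans subset_union_right) hgenᵢ)
        (fun g hg => hmonoᵢ g (hR₂ hg)) (Subset.refl _) false false (!xor c (constL I w₂.1 w₂.2.1 L)) fun x hx h2 h3 h => by
          rw [onslice x hx (Or.inl (cofᵢ x h2 h3))] at h
          revert h; cases xor c (constL I w₂.1 w₂.2.1 L) <;> decide
    have locⱼ : ChordLocal I cⱼ R.1 R.2 :=
      chordLocal_of_fail_slice hI hcⱼ hchⱼ (sliceGeneric_mono (hR₂.trans subset_union_right) hgenⱼ)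
        (fun g hg => hmonoⱼ g (hR₂ hg)) (Subset.refl _) false false (!xor c (constL I w₂.1 w₂.2.1 L)) fun x hx h2 h3 h => by
          rw [onslice x hx (Or.inr (cofⱼ x h2 h3))] at h
          revert h; cases xor c (constL I w₂.1 w₂.2.1 L) <;> decide
    have zero : ∀ x, gval I R.1 R.2 x = false := gval_eq_false_of_two_chordLocal hI hcᵢ hcⱼ hne hchᵢ hv locᵢ locⱼ
    -- compare with a solution on the slice
    obtain ⟨x₀, hx₀, e2, e3, -, -⟩ := exists_two_slices hI hcᵢ hcⱼ hne hchᵢ hchⱼ hv hgenᵢ false false false false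
    intro x
    have h₀ := onslice x₀ hx₀ (Or.inl (cofᵢ x₀ e2 e3))
    rw [zero] at h₀
    have hx := zero x
    rw [hR, gval_restrictL I hI hS] at hx
    revert h₀ hx; cases gval I w₂.1 w₂.2.1 (overrideL x L) <;> cases c <;> cases constL I w₂.1 w₂.2.1 L <;> decide
  have formula : ∀ x : Fin n → Bool, gval I w₂.1 w₂.2.1 x = xor (!w₂.2.2) (!mv I w₁.1 w₁.2.1 vᵢ x && !mv I w₁.1 w₁.2.1 vⱼ x) := by
    intro x
    have h := fibre x x
    rwa [overrideL_fibreList_self] at h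
  -- STEP: no (M0) witness — the restricted `Γ₁` on a both-dead fibre is constant but hits `b₁` at the witness
  obtain ⟨f, hf⟩ := ht.1
  obtain ⟨w, -, hw₁, hw₂⟩ := ht.2.2.2.2.2.2.2 f hf
  have dead : (!mv I w₁.1 w₁.2.1 vᵢ w && !mv I w₁.1 w₁.2.1 vⱼ w) = true := by
    have h := formula w
    rw [hw₂] at h
    revert h; cases w₂.2.2 <;> cases (!mv I w₁.1 w₁.2.1 vᵢ w && !mv I w₁.1 w₁.2.1 vⱼ w) <;> decide
  set L := fibreList Z w with hL
  set R₁ := restrictL I w₁.1 w₁.2.1 L with hR₁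
  have hR₁₂ : R₁.2 ⊆ w₁.2.1 := restrictL_snd_subset I _ _ L
  -- `Γ₁` restricted misses `b₁ ⊕ constL` on `Sol(J₀)`
  have miss : ∀ x : Fin n → Bool, (∀ j ∈ J₀, I.eval x j = y j) → gval I R₁.1 R₁.2 x ≠ xor w₁.2.2 (constL I w₁.1 w₁.2.1 L) := by
    intro x hx h
    rw [hR₁, gval_restrictL I hI hS] at h
    have hs := solves_overrideL_fibreList I hZout w hx
    have agree : ∀ u ∈ Z, overrideL x L u = w u := fun u hu => overrideL_fibreList_of_mem w x hu
    have h₂ : gval I w₂.1 w₂.2.1 (overrideL x L) = w₂.2.2 := by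
      rw [formula, liveᵢ_congr _ w agree, liveⱼ_congr _ w agree, dead]; cases w₂.2.2 <;> rfl
    refine ht.2.2.2.2.2.2.1 ⟨_, hs, ?_, h₂⟩
    revert h; cases gval I w₁.1 w₁.2.1 (overrideL x L) <;> cases w₁.2.2 <;> cases constL I w₁.1 w₁.2.1 L <;> decide
  -- hence it is constant (gSat) …
  have hconst : ∀ u u' : Fin n → Bool, gval I R₁.1 R₁.2 u = gval I R₁.1 R₁.2 u' := by
    by_contra hnc
    push Not at hnc
    obtain ⟨u, u', huu⟩ := hnc
    obtain ⟨x, hx, hxv⟩ := gSat n m r I hI hT hB hS y J₀ R₁.2 R₁.1 (xor w₁.2.2 (constL I w₁.1 w₁.2.1 L)) ht.2.2.1.le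
      (ht.2.2.2.1.mono_right hR₁₂) ⟨u, u', huu⟩
    exact miss x hx hxv
  -- … but it is `b₁ ⊕ constL` at the witness and not at a solution
  obtain ⟨x₀, hx₀, -⟩ := exists_two_slices hI hcᵢ hcⱼ hne hchᵢ hchⱼ hv hgenᵢ false false false false
  have hw : gval I R₁.1 R₁.2 w = xor w₁.2.2 (constL I w₁.1 w₁.2.1 L) := by
    rw [hR₁, gval_restrictL I hI hS, hL, overrideL_fibreList_self, hw₁]
  exact miss x₀ hx₀ ((hconst x₀ w).trans hw)

end Full

end Summit.PneNP.PneNP.Theorems.PstarChordReadNor
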